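import Mathlib
import Summits.Ventures.PercRepro2.Defs
import Summits.Ventures.PercRepro2.Graph
import Summits.Ventures.PercRepro2.Induced
import Summits.Ventures.PercRepro2.VdBKahn
import Summits.Ventures.PercRepro2.ReimerVdBK
import Summits.Ventures.PercRepro2.ReimerVdBKRegions
import Summits.Ventures.PercRepro2.ReimerVdBKZClosed
import Summits.Ventures.PercRepro2.ReimerVdBKZReduction
import Summits.Ventures.PercRepro2.ReimerVdBKZSplit
import Summits.Ventures.PercRepro2.ReimerVdBKZRecursion
import Summits.Ventures.PercRepro2.ReimerVdBKTypeWeight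
import Summits.Ventures.PercRepro2.ReimerVdBKPairType
import Summits.Ventures.PercRepro2.ReimerVdBKCoreDown

/-!
# (CORE-𝒟): the down-set statement on the core lattice, and its reductions
(blind cell PercRepro2, mine-c g47; `conjectures/MINE-C.md` §56.0–56.2, `proofs/MINEC-CORELATTICE.md`)

For a 2-colouring `ω` the CORE is `K₁ ∩ K₂` (`core`), the set of vertices reached by both worlds.  For a
family `D` of vertex sets closed under subsets (`IsDownSet`) and an instance `(A, X; B, Y)`, `coreDCount` counts
the colourings of the two-world event whose core lies in `D`, and **(CORE-𝒟)** (`CoreD`) says that the left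
count is at most the right count (for Harris pairs `X ∩ Y = ∅`, `A ∩ X = B ∩ Y = ∅`).  The principal down-sets
`avoidFamily N` (the subsets of `V ∖ N`) give back the core-avoidance counts of `ReimerVdBKCoreDown`
(`coreCount_eq_coreDCount`), so (CORE-𝒟) implies (CORE↓) on Harris pairs (`coreDown_of_coreD`) and hence
(R-1.2) for every instance (`rvdBK_of_coreD`, through `rvdBK_of_coreDown`).  The second face of (CORE-𝒟):
a core-non-increasing injection of the left event into the right event gives (CORE-𝒟) for every down-set
(`coreD_of_injOn`).  Census: 0 violations on every graph with ≤ 6 vertices, every Harris pair, every down-set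
(`MINE-C.md` §56.1, kit j333551), on 8,000 random 7-vertex graphs and 1,200 random 7-vertex multigraphs.
-/

namespace Summit.Ventures.PercRepro2
namespace ReimerVdBK
open Classical

variable {V : Type*} {E : Type*} [Fintype E] [DecidableEq E] [Fintype V] [DecidableEq V]
variable (ends : E → Sym2 V) (s : V)

/-! ## The core and down-sets of cores -/

/-- The core `K₁ ∩ K₂` of the colouring `ω` as a finite set: the vertices reached from `s` by both worlds
(the `Finset` version of `core` of `ReimerVdBKRegions`). -/
noncomputable def coreFin (ω : Config E) : Finset V :=
  Finset.univ.filter fun v => Conn ends ω s v ∧ Conn ends (compl ω) s v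

omit [DecidableEq E] in
/-- Membership in the core. -/
lemma mem_coreFin_iff (ω : Config E) (v : V) :
    v ∈ coreFin ends s ω ↔ Conn ends ω s v ∧ Conn ends (compl ω) s v := by
  simp [coreFin]

omit [DecidableEq E] in
/-- `coreFin` is the core of `ReimerVdBKRegions`. -/
lemma mem_coreFin_iff_mem_core (ω : Config E) (v : V) :
    v ∈ coreFin ends s ω ↔ v ∈ core ends s ω := by
  rw [mem_coreFin_iff]
  rfl

omit [DecidableEq E] in
/-- The root is in every core. -/
lemma root_mem_coreFin (ω : Config E) : s ∈ coreFin ends s ω := by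
  rw [mem_coreFin_iff]
  exact ⟨conn_refl ends ω s, conn_refl ends (compl ω) s⟩

omit [Fintype E] [DecidableEq E] [Fintype V] [DecidableEq V] in
/-- A family of vertex sets closed under taking subsets. -/
def IsDownSet (D : Finset (Finset V)) : Prop := ∀ C ∈ D, ∀ C' : Finset V, C' ⊆ C → C' ∈ D

/-- The count of colourings of the two-world event of `(A, X; B, Y)` whose core lies in the family `D`. -/
noncomputable def coreDCount (A X B Y : Finset V) (D : Finset (Finset V)) : ℕ :=
  count (twoWorld ends s A X B Y ∩ {ω | coreFin ends s ω ∈ D})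

/-- **(CORE-𝒟) for the instance `(A, X; B, Y)` and the family `D`**: among the colourings whose core lies
in `D`, the left event is at most as large as the right event.  (Meant for Harris pairs and down-sets `D`;
`D = avoidFamily N` is (CORE↓), `D = ` all sets is Harris.) -/
def CoreD (A X B Y : Finset V) (D : Finset (Finset V)) : Prop :=
  coreDCount ends s A X B Y D ≤ coreDCount ends s (A ∪ B) ∅ ∅ (X ∪ Y) D

/-! ## The principal down-sets are the core-avoidance weights -/

omit [DecidableEq E] in
/-- The principal down-set of the cores avoiding `N`: all subsets of `V ∖ N`. -/
def avoidFamily (N : Finset V) : Finset (Finset V) := (Finset.univ \ N).powerset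

omit [DecidableEq E] in
/-- `avoidFamily N` is a down-set. -/
lemma isDownSet_avoidFamily (N : Finset V) : IsDownSet (avoidFamily (V := V) N) := by
  intro C hC C' hC'
  simp only [avoidFamily, Finset.mem_powerset] at hC ⊢
  exact hC'.trans hC

omit [DecidableEq E] in
/-- The core lies in `avoidFamily N` iff it avoids `N`. -/
lemma coreFin_mem_avoidFamily_iff (ω : Config E) (N : Finset V) :
    coreFin ends s ω ∈ avoidFamily N ↔ ∀ v ∈ N, ¬ (Conn ends ω s v ∧ Conn ends (compl ω) s v) := by
  unfold avoidFamily
  rw [Finset.mem_powerset]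
  constructor
  · intro h v hv hc
    have hmem : v ∈ coreFin ends s ω := (mem_coreFin_iff ends s ω v).2 hc
    have h2 := h hmem
    rw [Finset.mem_sdiff] at h2
    exact h2.2 hv
  · intro h v hv
    rw [mem_coreFin_iff] at hv
    rw [Finset.mem_sdiff]
    exact ⟨Finset.mem_univ v, fun hvN => h v hvN hv⟩

/-- The core-avoidance count of `ReimerVdBKCoreDown` is the count over the principal down-set. -/
theorem coreCount_eq_coreDCount (A X B Y N : Finset V) :
    coreCount ends s A X B Y N = coreDCount ends s A X B Y (avoidFamily N) := by
  unfold coreCount coreDCount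
  rw [pcount_coreW_eq_count]
  congr 1
  ext ω
  simp only [Set.mem_inter_iff, Set.mem_setOf_eq]
  rw [coreFin_mem_avoidFamily_iff]

/-- **(CORE-𝒟) implies (CORE↓)**: if the instance satisfies (CORE-𝒟) for every down-set, it satisfies
(CORE↓) for every set `N`. -/
theorem coreDown_of_coreD (A X B Y : Finset V)
    (h : ∀ D : Finset (Finset V), IsDownSet D → CoreD ends s A X B Y D) (N : Finset V) :
    CoreDown ends s A X B Y N := by
  unfold CoreDown
  rw [coreCount_eq_coreDCount, coreCount_eq_coreDCount]
  exact h _ (isDownSet_avoidFamily N)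

/-- **(R-1.2) follows from (CORE-𝒟) on Harris pairs**: if for every graph (on the given vertex and edge
types), every Harris pair and every down-set `D` of vertex sets the core-restricted counts are ordered, then
`Φ(A, X; B, Y) ≤ Φ(A ∪ B, X ∩ Y; ∅, X ∪ Y)` for every instance on every such graph. -/
theorem rvdBK_of_coreD
    (hCD : ∀ (ends : E → Sym2 V) (A X B Y : Finset V) (D : Finset (Finset V)), X ∩ Y = ∅ →
      Disjoint A X → Disjoint B Y → IsDownSet D → CoreD ends s A X B Y D) :
    ∀ (ends : E → Sym2 V) (A X B Y : Finset V), RvdBK ends s A X B Y := by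
  apply rvdBK_of_coreDown
  intro ends A X B Y N hXY hAX hBY _
  exact coreDown_of_coreD ends s A X B Y (fun D hD => hCD ends A X B Y D hXY hAX hBY hD) N

/-! ## The second face: a core-non-increasing injection -/

omit [Fintype V] [DecidableEq V] in
/-- A count is a cardinality. -/
lemma count_eq_card' (S : Set (Config E)) :
    count S = (Finset.univ.filter (fun ω : Config E => ω ∈ S)).card := by
  unfold count
  rw [Finset.card_filter]

/-- **A core-non-increasing injection gives (CORE-𝒟)**: if `Ψ` maps the left event injectively into the
right event and never enlarges the core, then (CORE-𝒟) holds for every down-set `D`. -/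
theorem coreD_of_injOn (A X B Y : Finset V) (Ψ : Config E → Config E)
    (hmap : ∀ ω ∈ twoWorld ends s A X B Y, Ψ ω ∈ twoWorld ends s (A ∪ B) ∅ ∅ (X ∪ Y))
    (hcore : ∀ ω ∈ twoWorld ends s A X B Y, core ends s (Ψ ω) ⊆ core ends s ω)
    (hinj : Set.InjOn Ψ (twoWorld ends s A X B Y))
    (D : Finset (Finset V)) (hD : IsDownSet D) : CoreD ends s A X B Y D := by
  unfold CoreD coreDCount
  rw [count_eq_card', count_eq_card']
  apply Finset.card_le_card_of_injOn Ψ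
  · intro ω hω
    simp only [Finset.coe_filter, Finset.mem_univ, true_and, Set.mem_inter_iff, Set.mem_setOf_eq] at hω ⊢
    refine ⟨hmap ω hω.1, hD _ hω.2 _ ?_⟩
    intro v hv
    rw [mem_coreFin_iff_mem_core] at hv ⊢
    exact hcore ω hω.1 hv
  · intro ω hω ω' hω' h
    simp only [Finset.coe_filter, Finset.mem_univ, true_and, Set.mem_inter_iff, Set.mem_setOf_eq] at hω hω'
    exact hinj hω.1 hω'.1 h

/-! ## Status of the hypothesis (mine-c g47, appended the same day; `MINE-C.md` §56.6)

(CORE-𝒟) for ALL down-sets is FALSE from 8 vertices on: on the simple graph with root `s` adjacent to every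
vertex and the further edges `1–2, 1–7, 2–6, 3–6, 4–7, 5–7`, with `A = {4, 5}`, `B = {3, 6}`, `X = Y = ∅`,
one has `#L = 2367 ≤ #R = 2404` and (CORE↓) for every `S`, but the down-set «`3 ∉ C` and none of
`{1, 6}`, `{2, 7}`, `{6, 7}` is contained in `C`» counts `272` colourings of `L` against `264` of `R`
(three independent codes).  So `rvdBK_of_coreD` is to be read as an implication whose hypothesis fails
(like `rvdBK_of_cna_cpa`), and `coreD_of_injOn` says that no core-non-increasing injection exists there.
What survives is exactly the PRINCIPAL case — (CORE↓), the product weights `Π_{v ∈ N} [v ∉ K₁ ∩ K₂]`,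
the hypothesis of `rvdBK_of_coreDown` — and on principal down-sets the two statements coincide:
-/

/-- **(CORE↓) gives (CORE-𝒟) on the principal down-set**: the converse of `coreDown_of_coreD` for
`D = avoidFamily N`. -/
theorem coreD_avoidFamily_of_coreDown (A X B Y N : Finset V) (h : CoreDown ends s A X B Y N) :
    CoreD ends s A X B Y (avoidFamily N) := by
  unfold CoreD
  rw [← coreCount_eq_coreDCount, ← coreCount_eq_coreDCount]
  exact h

/-- On principal down-sets, (CORE-𝒟) and (CORE↓) are the same statement. -/
theorem coreD_avoidFamily_iff_coreDown (A X B Y N : Finset V) :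
    CoreD ends s A X B Y (avoidFamily N) ↔ CoreDown ends s A X B Y N := by
  unfold CoreD CoreDown
  rw [coreCount_eq_coreDCount, coreCount_eq_coreDCount]

end ReimerVdBK
end Summit.Ventures.PercRepro2
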